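import Summits.QuantumFields.YangMills.Theorems.BalabanUVNodesN11ChargedSepJunctionOfSolvable
import Summits.QuantumFields.YangMills.Theorems.BalabanUVNodesN11OneBlockLevels

/-!
# DAG node N11 — THE NO-EXPANSION 𝐓-STEP FACES KEYED ON THE bg FACT: dag-n11-d's four endpoint faces at the charged separated indices
# (`…SpaceTruncationChargedSep` ∕ `…ChargedSepJunctionOfSolvable`) with the record row's triple `(Provisos₁₃SepCoPH.bg, window, PartCompat₁₃)` REPLACED by the
# CONTENT of row P11 at `(p, k)` — `BgProvisoΛ … k (suppOfRecord₁₃SepCoP …) (UbgOfRecord₁₃CoP …)` — and, at `M = L^a`, the cube cover from the nesting numeric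
# alone (dag-n11-w4's `cover_row_of_nesting_of_powM`): THE RUN GUARD `PartCompat₁₃` DISAPPEARS FROM THE NO-EXPANSION HALF, its former content displayed as `hbg`

HEADER — WORK-UNIT METADATA.  Cell `pub-ymgap`, YM-PLAN Track A (HUMAN RULING D-0062 ∕ D-0149 width seats), seat `pub-ymgap-dag-n11-w1` (g3; WIDTH SEAT 1 of 4 on NODE n11
[B14]), route `BalabanUVNodes` rev 27 (Variant R), KEY item K1⁸ `StabilityBRunRowsAtRecordR13SepCoPH` = stmt-QuantumFields-26907 (dag-lead KEY MAP ∕ GATE v1.65, 2026-08-28T08:12Z;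
helper lane `--kind proof --supports 26907 --as helper`, count-neutral; K1⁷ 20542 = aside).  dag-n11-d g15's HAND-OUT «n11-w1 take it» on this seat's ASK-NEXT (o5) (pub-ymgap
INBOX 2026-08-28T09:07Z: «the `hbg`-keyed editions of my `…SpaceTruncationChargedSep` ∕ `…ChargedSepJunctionOfSolvable` endpoint faces with `(Provisos.bg, hw, hPC)` replaced by the
bg FACT, AND — same edition — `hcov` discharged by n11-w4 p618164 §4 `cover_row_of_nesting_of_powM` at `M = L^a`; new file, your name, imports mine; nothing of mine re-typed»;
dag-n11-w4 g4's offer folded; dag-n11-w5 g2 redirected here).  [III] = [Balaban1988Convergent], [15] = [Balaban1985Variational], [B7] = [Balaban1985Averaging].  Over dag-n11-d's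
`…SpaceTruncationCharged` (p589738∕p591695: `exists_local_witness_clause_succ_of_sLaw₁₃CoPH_of_bgReadCharged`, `…_of_hasSect2FormAtZS_of_borelB_of_bgReadCharged`),
`…SpaceTruncationChargedSep` (p594941: `bgProvisoΛ_charged_of_sep_of_junctionCharged` — which already takes the bg FACT as an argument), `…ChargedSepJunctionOfSolvable`
(p596158: `sepJunctionCharged_of_solvable`), dag-n11-w4's `…OneBlockLevels` (p618164: `cover_row_of_nesting_of_powM`), def-T's `Node00/Record13(CoPH)` (`BgProvisoΛ`,
`suppOfRecord₁₃SepCoP`, `UbgOfRecord₁₃CoP`, `Provisos₁₃CoPH`).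

WHY THIS FILE.  In the record (def-T `Node00/Record13` v1.2 §9) the background-regularity row P11 `Provisos₁₃Sep(CoPH).bg` is GUARDED: it yields `BgProvisoΛ` at `(p, k)` only for
`k ≤ K`, a windowed run, AND `PartCompat₁₃ θ p k` («all partitions are compatible», [III] p. 257 — «a range restriction on runs, of the same kind as the window»).  dag-n11-w4 g4
(p615408 ∕ p617030 ∕ p618164) located that the guard is a floor on the last coupling, that the ∀-window guard binder of the printed faces is unsatisfiable, and that below the floor
the GEOMETRY of the no-expansion 𝐓-step (the cube cover `hcov`) survives at `M = L^a` (one-block levels: regions are `∅` or the torus) — so «what stays guarded is K0's row `bg`».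
dag-n11-d's no-expansion faces read the guard in exactly these two places: `hsep.bg p k hk.le hw hPC` and `hcov`.  THIS FILE re-keys the four endpoint faces on the bg FACT
ITSELF (`hbg`, the content of row P11 at `(p, k)`, however obtained — from the guarded row on compatible runs, or from a future unguarded ∕ one-block [15] supplier) and folds
dag-n11-w4's guard-free cover: (§1) the two faces at the charged separated indices (`hJ` displayed) from `(Provisos₁₃CoPH, window, hbg)` — one-line compositions of
`…_of_bgReadCharged` with `bgProvisoΛ_charged_of_sep_of_junctionCharged … hbg hJ`; (§2) the two faces with the junction's top half discharged (solvability, (7)-data,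
numerics, `2 ≤ cR`) from the same plus `L·M₂ ∣ M`, `M = L^a` — `hcov` supplied by `cover_row_of_nesting_of_powM` at the level `k` — so that NO `PartCompat₁₃` occurs in the
no-expansion half at `M = L^a`.  The ZhPin ∕ same-witness ∕ BorelB-road layers above (p604229 ∕ p605244 ∕ this seat's A–G) re-key on these by the same one-line substitutions
(sequel, on the lanes' word).

WHAT THIS FILE PROVES (4 theorems, 0 `def`, 0 `sorry`; standard axioms; every proof ONE composition BY NAME; conclusions VERBATIM dag-n11-d's).
§1 ★ `exists_local_witness_clause_succ_of_sLaw₁₃CoPH_of_sep_of_junctionCharged_of_bgFact` · ★ `exists_local_witness_clause_succ_of_hasSect2FormAtZS_of_borelB_of_sep_of_junctionCharged_of_bgFact`.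
§2 ★★ `exists_local_witness_clause_succ_of_sLaw₁₃CoPH_of_sep_of_solvable_of_bgFact_of_powM` · ★★ `exists_local_witness_clause_succ_of_hasSect2FormAtZS_of_borelB_of_sep_of_solvable_of_bgFact_of_powM`.

HONEST FRAMING.  Helper lane of K1⁸, count-neutral KERNEL BOOKKEEPING (argument substitution in landed theorems); `hbg` (= [III] (2.28) ∕ [15] Thm 1 at the record's collar-class
background — K0 ∕ def-R content), K0's solvability, the (7)-data clause, 12a″'s `RegOn`, `2 ≤ cR` (uninhabited at every witness of record, dag-n11-d LOCATED-cR) and every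
numeric row are DISPLAYED HYPOTHESES; nothing of Bałaban asserted; no statement about which runs carry `hbg`.  N11 NOT discharged; K1⁸ ∕ K1⁷ NOT closed, no registered stub
touched; counts unmoved (typed 28∕28 · discharged 5∕27).  One finite `𝕋⁴_{L^K}` programme at fixed `ε = L^{−K}`; R4 closes only the conditional finite-𝕋⁴ rung
`BalabanLadder.UV` — NOT ℝ⁴, NOT OS, NOT a mass gap, NOT Clay.  No `sorry`, no `axiom`, no `def`, no `instance`, no `notation`.
Sources (SHAPE only): [III] Theorem p.245, Thm 1 p.262, (2.1) p.254, (2.5) p.255, (2.10) p.256, (2.16)–(2.18) p.257, p.257 («compatible»), p.267, (2.28) p.259, (3.5) p.265,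
(3.24)–(3.25) p.270; [15] Thm 1 (7)–(8) pp.278–279; [B7] Prop. 2 p.26; [Balaban1985RegularSpaces] (1.3)–(1.6) p.77.
-/

noncomputable section

open MeasureTheory
open scoped BigOperators ENNReal NNReal Matrix.Norms.L2Operator

namespace Summit.QuantumFields.YangMills.Theorems.BalabanUVNodesN11ChargedSepFacesOfBgFact

open Literature.MathematicalPhysics.QuantumFieldTheory.Balaban1983to89 T4Continuum T4NestedCovariance Node00 Node00.Tk DagBinding
open B15DeterminingSets B8Eq17ClassAkV1 B14.Eq218Concrete
open B14.Eq213MaximalDomains (side)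
open B14.Eq213DetSet (Bj)
open B14.Eq216Concrete (ukBox)
open Literature.MathematicalPhysics.QuantumFieldTheory.BalabanImbrieJaffe1984to88.BIJ85Eq453GaugeField (qsstarGIter0)
open BalabanUVNodesN11FluctTruncationDefs (IsFluctLocal)
open BalabanUVNodesN11SpaceTruncationDefs BalabanUVNodesN11SpaceTruncationBorelBDefs
open BalabanUVNodesN11SpaceTruncationCharged (exists_local_witness_clause_succ_of_sLaw₁₃CoPH_of_bgReadCharged
  exists_local_witness_clause_succ_of_hasSect2FormAtZS_of_borelB_of_bgReadCharged)
open BalabanUVNodesN11SpaceTruncationChargedSep (bgProvisoΛ_charged_of_sep_of_junctionCharged)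
open BalabanUVNodesN11ChargedSepJunctionOfSolvable (sepJunctionCharged_of_solvable)
open BalabanUVNodesN11OneBlockLevels (cover_row_of_nesting_of_powM)

variable {F : T4Family} {N : ℕ} [NeZero N]

/-! ## §1  The two faces at the charged separated indices (p591971 layer), keyed on the bg FACT — no run guard -/

section JunctionCharged

variable (θ : Stage13HParams F N) (p : B12.RunParams)

/-- **★ THE SLaw-KEYED FACE AT THE CHARGED SEPARATED INDICES, KEYED ON THE bg FACT** — dag-n11-d's `exists_local_witness_clause_succ_of_sLaw₁₃CoPH_of_sep_of_junctionCharged`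
(p591971∕`…SpaceTruncationChargedSep`) with its triple `(Provisos₁₃SepCoPH.bg, window, PartCompat₁₃)` REPLACED by the CONTENT of the record's P11 row at `(p, k)` —
`hbg : BgProvisoΛ … k (suppOfRecord₁₃SepCoP …) (UbgOfRecord₁₃CoP …)` — and the core provisos; NO run guard (the window stays: the sibling's `_of_bgReadCharged` reads it).
Conclusion VERBATIM.  [cite: Balaban1988Convergent, Theorem p.245, Thm 1 p.262, (2.1) p.254, (2.10) p.256, (2.28) p.259, (3.5) p.265, (3.24)–(3.25) p.270; Balaban1985RegularSpaces, (1.3)–(1.6) p.77] -/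
theorem exists_local_witness_clause_succ_of_sLaw₁₃CoPH_of_sep_of_junctionCharged_of_bgFact (h : θ.Provisos₁₃CoPH F N) (hU : θ.ZhUnity F N) (hθ : θ.Admissible F N)
    (hpos : θ.s2.Pos) (hM₁ : 0 < θ.ν.M₁) (hle : θ.ν.M₁ ≤ θ.τ9.M) {k : ℕ} (hk : k < p.K) (hM : 1 ≤ θ.τ9.M)
    (hw : Step.InInterval θ.γ k (gOfRecord₁₃ F N θ.toStage13Params p))
    (hbg : BgProvisoΛ F N p.K (settingOfRecord₁₃ F N θ.toStage13Params p) (θ.Rz p.K) θ.τ9.M k (suppOfRecord₁₃SepCoP F N θ.toStage13Params p k)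
      (UbgOfRecord₁₃CoP F N θ.toStage13Params p k)) (cR : ℝ)
    (Γr : SeqOfRecord F θ.ν θ.τ9.M (gOfRecord₁₃ F N θ.toStage13Params p) p.K k → ℕ → Set (Site (F.P p.K) 0) → Set (Site (F.P p.K) 0))
    (hreg : ∀ s₀, (θ.zhAt p s₀).RegOn F N (FluctV N) θ.ν cR p (gOfRecord₁₃ F N θ.toStage13Params p) (Γr s₀))
    (hJ : ∀ s₀, slotsOfRecord F N θ.ν θ.τ9 (EOfRecord₁₃ F N θ.toStage13Params) (wOfRecord₉ F N θ.toStage9Params) θ.ppSel p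
        (gOfRecord₁₃ F N θ.toStage13Params p) k s₀ ≠ 0 → Sect2.SeqSeparated θ.ν.M₁ s₀ → ∀ Wc : MSField (F.P p.K) (SU N),
      chiSeqOfRecord F N θ.ν θ.τ9.M (gOfRecord₁₃ F N θ.toStage13Params p) p.K k s₀ (Wc k) ≠ 0 →
      (∀ j, j < k → PlaqSmallOn (plaqsOf (pts j (Γr s₀ j (s₀.Ω (j + 1))ᶜ))) (cR * epsOfRecord θ.ν (gOfRecord₁₃ F N θ.toStage13Params p) j) (Wc j)) →
      Wc ∈ suppOfRecord₁₃SepCoP F N θ.toStage13Params p k s₀)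
    (hS : SLaw₁₃CoPH F N θ p k) :
    ∃ (t : SeqOfRecord F θ.ν θ.τ9.M (gOfRecord₁₃ F N θ.toStage13Params p) p.K k → Sect2.TermValues (F.P p.K) (MatA N) (FluctV N) θ.τ9.M)
      (Ek : SeqOfRecord F θ.ν θ.τ9.M (gOfRecord₁₃ F N θ.toStage13Params p) p.K k → ℝ),
      HasSect2FormAtZS F N (FluctV N) p.K (settingOfRecord₁₃ F N θ.toStage13Params p) k (θ.rzAt p) (WtOfRecord₁₃H F N θ p)
          (UbgOfRecord₁₃CoP F N θ.toStage13Params p k)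
          (fun s₀ t₀ => Sect2.LawsRT (sect2TowerOfRecord F N (FluctV N) p.K (settingOfRecord₁₃ F N θ.toStage13Params p) (θ.rzAt p s₀) s₀ t₀)
            (settingOfRecord₁₃ F N θ.toStage13Params p).lf k)
          (slotsOfRecord F N θ.ν θ.τ9 (EOfRecord₁₃ F N θ.toStage13Params) (wOfRecord₉ F N θ.toStage9Params) θ.ppSel p
            (gOfRecord₁₃ F N θ.toStage13Params p) k) t Ek ∧
      (∀ s₀, IsFluctLocal k (t s₀)) ∧
      ∀ (s : SeqOfRecord F θ.ν θ.τ9.M (gOfRecord₁₃ F N θ.toStage13Params p) p.K (k + 1)), s.Ω (k + 1) = ∅ →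
        -- (P) prefix agreement below `k`
        (∀ j, j < k → (θ.zhAt p s).ζ0 j = (θ.zhAt p s.init).ζ0 j ∧ (θ.zhAt p s).quad j = (θ.zhAt p s.init).quad j) →
        -- (V) the generation-`k` pin with the old front factor
        (∀ (V' : GaugeField (F.P p.K) (k + 1) (SU N)) (U₀ : GaugeField (F.P p.K) k (SU N)),
          (θ.zhAt p s).ζ0 k Set.univ (pairCfgAt (V := FluctV N) k V' U₀) =
            chiSeqOfRecord F N θ.ν θ.τ9.M (gOfRecord₁₃ F N θ.toStage13Params p) p.K k s.init U₀ *
              wOfRecord₉ F N θ.toStage9Params p (gOfRecord₁₃ F N θ.toStage13Params p) k s U₀ ((avOfRecord F N p.K k).avg U₀)) →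
        -- `quad_k(∅) = 0` on the two-scale configurations
        (∀ (V' : GaugeField (F.P p.K) (k + 1) (SU N)) (U₀ : GaugeField (F.P p.K) k (SU N)), (θ.zhAt p s).quad k ∅ (pairCfgAt (V := FluctV N) k V' U₀) = 0) →
        -- `k`-locality of `quad_j(Λ_{j+1})`, `j < k`
        (∀ j, j < k → ∀ ω ω' : MultiCfg (F.P p.K) (SU N) (FluctV N), (∀ i, i ≤ k → ω i = ω' i) →
          (θ.zhAt p s).quad j (s.init.Λ (j + 1)) ω = (θ.zhAt p s).quad j (s.init.Λ (j + 1)) ω') →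
        -- measurability of the residual serving `s′`
        (∀ j (Y : Set (Site (F.P p.K) 0)), Measurable ((θ.zhAt p s).ζ0 j Y)) →
        (∀ j (Λ' : Set (Site (F.P p.K) 0)), Measurable ((θ.zhAt p s).quad j Λ')) →
        -- per old branch: A-fibre domination (K0b)
        (∀ S ∈ admSOfRecord F θ.ν θ.τ9.M (gOfRecord₁₃ F N θ.toStage13Params p) p.K k s.init, ∀ j : ℕ,
          ∃ ŵ : (↥(Set.toFinite (B10Eq42TorusConstraint.bondsIn j ((s.init.Λ (j + 1))ᶜ ∩ s.init.Ω (j + 1)))).toFinset → FluctV N) → ℝ≥0∞, Measurable ŵ ∧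
            (∫⁻ a, ŵ a ∂(Measure.pi fun _ : ↥(Set.toFinite (B10Eq42TorusConstraint.bondsIn j ((s.init.Λ (j + 1))ᶜ ∩ s.init.Ω (j + 1)))).toFinset => (volume : Measure (FluctV N)))) ≠ ⊤ ∧
            ∀ ω, ENNReal.ofReal ((WtOfRecord₁₃H F N θ p s).w j (s.init.Λ (j + 1)) ((s.init.Λ (j + 1))ᶜ ∩ s.init.Ω (j + 1)) (S (j + 1)) ω) ≤
              ŵ (fun b : ↥(Set.toFinite (B10Eq42TorusConstraint.bondsIn j ((s.init.Λ (j + 1))ᶜ ∩ s.init.Ω (j + 1)))).toFinset => (ω j).2 b)) →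
        -- def-T: the 𝐁-terms of the witness at the parent history, READ AT THE EMBEDDED BACKGROUND, are JOINTLY measurable in `(U, A)` (LOCATED residue)
        (∀ (S' : ℕ → Set (Site (F.P p.K) 0)) (j : ℕ) (X : (Sect2.domSys (F.P p.K) θ.τ9.M j).Dom),
          Measurable (fun q : GaugeField (F.P p.K) 0 (SU N) × MSFluct (F.P p.K) (FluctV N) =>
            ((t s.init).B j X (Sect2.ofBackgroundC (settingOfRecord₁₃ F N θ.toStage13Params p).ι q.1) (S', q.2)).re)) →
        (slotsTOfRecord F N θ.ν θ.τ9 (EOfRecord₁₃ F N θ.toStage13Params) (wOfRecord₉ F N θ.toStage9Params) θ.ppSel p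
            (gOfRecord₁₃ F N θ.toStage13Params p) (k + 1) s = 0 ∨
          ∀ᵐ V' ∂fieldMeasure (F.P p.K) (k + 1) (SU N),
            chiSeqOfRecord F N θ.ν θ.τ9.M (gOfRecord₁₃ F N θ.toStage13Params p) p.K (k + 1) s V' ≠ 0 →
              slotsTOfRecord F N θ.ν θ.τ9 (EOfRecord₁₃ F N θ.toStage13Params) (wOfRecord₉ F N θ.toStage9Params) θ.ppSel p
                  (gOfRecord₁₃ F N θ.toStage13Params p) (k + 1) s V' =
                sect2Slot F N (FluctV N) p.K (settingOfRecord₁₃ F N θ.toStage13Params p) (θ.rzAt p s) (WtOfRecord₁₃H F N θ p s) s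
                  (t s.init) (Ek s.init) (UbgOfRecord₁₃CoP F N θ.toStage13Params p (k + 1) s) V') :=
  exists_local_witness_clause_succ_of_sLaw₁₃CoPH_of_bgReadCharged θ p h hU hθ hpos hk hM hw cR Γr hreg
    (bgProvisoΛ_charged_of_sep_of_junctionCharged θ p hM₁ hle cR Γr hbg hJ) hS

/-- **★ THE WITNESS-FIRST FACE AT THE CHARGED SEPARATED INDICES, KEYED ON THE bg FACT** — dag-n11-d's
`exists_local_witness_clause_succ_of_hasSect2FormAtZS_of_borelB_of_sep_of_junctionCharged` with `(Provisos₁₃SepCoPH.bg, window, PartCompat₁₃)` ↦ `(Provisos₁₃CoPH, window, hbg)`;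
NO run guard; conclusion VERBATIM. [cite: Balaban1988Convergent, Theorem p.245, Thm 1 p.262, (2.1) p.254, (2.10) p.256, (2.28) p.259, (3.5) p.265, (3.24)–(3.25) p.270; Balaban1985RegularSpaces, (1.3)–(1.6) p.77] -/
theorem exists_local_witness_clause_succ_of_hasSect2FormAtZS_of_borelB_of_sep_of_junctionCharged_of_bgFact (h : θ.Provisos₁₃CoPH F N) (hU : θ.ZhUnity F N)
    (hθ : θ.Admissible F N) (hpos : θ.s2.Pos) (hM₁ : 0 < θ.ν.M₁) (hle : θ.ν.M₁ ≤ θ.τ9.M) {k : ℕ} (hk : k < p.K) (hM : 1 ≤ θ.τ9.M)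
    (hw : Step.InInterval θ.γ k (gOfRecord₁₃ F N θ.toStage13Params p))
    (hbg : BgProvisoΛ F N p.K (settingOfRecord₁₃ F N θ.toStage13Params p) (θ.Rz p.K) θ.τ9.M k (suppOfRecord₁₃SepCoP F N θ.toStage13Params p k)
      (UbgOfRecord₁₃CoP F N θ.toStage13Params p k)) (cR : ℝ)
    (Γr : SeqOfRecord F θ.ν θ.τ9.M (gOfRecord₁₃ F N θ.toStage13Params p) p.K k → ℕ → Set (Site (F.P p.K) 0) → Set (Site (F.P p.K) 0))
    (hreg : ∀ s₀, (θ.zhAt p s₀).RegOn F N (FluctV N) θ.ν cR p (gOfRecord₁₃ F N θ.toStage13Params p) (Γr s₀))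
    (hJ : ∀ s₀, slotsOfRecord F N θ.ν θ.τ9 (EOfRecord₁₃ F N θ.toStage13Params) (wOfRecord₉ F N θ.toStage9Params) θ.ppSel p
        (gOfRecord₁₃ F N θ.toStage13Params p) k s₀ ≠ 0 → Sect2.SeqSeparated θ.ν.M₁ s₀ → ∀ Wc : MSField (F.P p.K) (SU N),
      chiSeqOfRecord F N θ.ν θ.τ9.M (gOfRecord₁₃ F N θ.toStage13Params p) p.K k s₀ (Wc k) ≠ 0 →
      (∀ j, j < k → PlaqSmallOn (plaqsOf (pts j (Γr s₀ j (s₀.Ω (j + 1))ᶜ))) (cR * epsOfRecord θ.ν (gOfRecord₁₃ F N θ.toStage13Params p) j) (Wc j)) →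
      Wc ∈ suppOfRecord₁₃SepCoP F N θ.toStage13Params p k s₀)
    (t₀ : SeqOfRecord F θ.ν θ.τ9.M (gOfRecord₁₃ F N θ.toStage13Params p) p.K k → Sect2.TermValues (F.P p.K) (MatA N) (FluctV N) θ.τ9.M)
    (E₀ : SeqOfRecord F θ.ν θ.τ9.M (gOfRecord₁₃ F N θ.toStage13Params p) p.K k → ℝ)
    (hform₀ : HasSect2FormAtZS F N (FluctV N) p.K (settingOfRecord₁₃ F N θ.toStage13Params p) k (θ.rzAt p) (WtOfRecord₁₃H F N θ p)
      (UbgOfRecord₁₃CoP F N θ.toStage13Params p k)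
      (fun s₀ t' => Sect2.LawsRT (sect2TowerOfRecord F N (FluctV N) p.K (settingOfRecord₁₃ F N θ.toStage13Params p) (θ.rzAt p s₀) s₀ t')
        (settingOfRecord₁₃ F N θ.toStage13Params p).lf k)
      (slotsOfRecord F N θ.ν θ.τ9 (EOfRecord₁₃ F N θ.toStage13Params) (wOfRecord₉ F N θ.toStage9Params) θ.ppSel p (gOfRecord₁₃ F N θ.toStage13Params p) k) t₀ E₀)
    (hBt : ∀ s₀ (S' : ℕ → Set (Site (F.P p.K) 0)) (j : ℕ) (X : (Sect2.domSys (F.P p.K) θ.τ9.M j).Dom),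
      Measurable (fun q : GaugeField (F.P p.K) 0 (SU N) × MSFluct (F.P p.K) (FluctV N) =>
        (t₀ s₀).B j X (Sect2.ofBackgroundC (settingOfRecord₁₃ F N θ.toStage13Params p).ι q.1) (S', q.2))) :
    ∃ (t : SeqOfRecord F θ.ν θ.τ9.M (gOfRecord₁₃ F N θ.toStage13Params p) p.K k → Sect2.TermValues (F.P p.K) (MatA N) (FluctV N) θ.τ9.M)
      (Ek : SeqOfRecord F θ.ν θ.τ9.M (gOfRecord₁₃ F N θ.toStage13Params p) p.K k → ℝ),
      HasSect2FormAtZS F N (FluctV N) p.K (settingOfRecord₁₃ F N θ.toStage13Params p) k (θ.rzAt p) (WtOfRecord₁₃H F N θ p)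
          (UbgOfRecord₁₃CoP F N θ.toStage13Params p k)
          (fun s₀ t₀ => Sect2.LawsRT (sect2TowerOfRecord F N (FluctV N) p.K (settingOfRecord₁₃ F N θ.toStage13Params p) (θ.rzAt p s₀) s₀ t₀)
            (settingOfRecord₁₃ F N θ.toStage13Params p).lf k)
          (slotsOfRecord F N θ.ν θ.τ9 (EOfRecord₁₃ F N θ.toStage13Params) (wOfRecord₉ F N θ.toStage9Params) θ.ppSel p
            (gOfRecord₁₃ F N θ.toStage13Params p) k) t Ek ∧
      (∀ s₀, IsFluctLocal k (t s₀)) ∧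
      ∀ (s : SeqOfRecord F θ.ν θ.τ9.M (gOfRecord₁₃ F N θ.toStage13Params p) p.K (k + 1)), s.Ω (k + 1) = ∅ →
        -- (P) prefix agreement below `k`
        (∀ j, j < k → (θ.zhAt p s).ζ0 j = (θ.zhAt p s.init).ζ0 j ∧ (θ.zhAt p s).quad j = (θ.zhAt p s.init).quad j) →
        -- (V) the generation-`k` pin with the old front factor
        (∀ (V' : GaugeField (F.P p.K) (k + 1) (SU N)) (U₀ : GaugeField (F.P p.K) k (SU N)),
          (θ.zhAt p s).ζ0 k Set.univ (pairCfgAt (V := FluctV N) k V' U₀) =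
            chiSeqOfRecord F N θ.ν θ.τ9.M (gOfRecord₁₃ F N θ.toStage13Params p) p.K k s.init U₀ *
              wOfRecord₉ F N θ.toStage9Params p (gOfRecord₁₃ F N θ.toStage13Params p) k s U₀ ((avOfRecord F N p.K k).avg U₀)) →
        -- `quad_k(∅) = 0` on the two-scale configurations
        (∀ (V' : GaugeField (F.P p.K) (k + 1) (SU N)) (U₀ : GaugeField (F.P p.K) k (SU N)), (θ.zhAt p s).quad k ∅ (pairCfgAt (V := FluctV N) k V' U₀) = 0) →
        -- `k`-locality of `quad_j(Λ_{j+1})`, `j < k`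
        (∀ j, j < k → ∀ ω ω' : MultiCfg (F.P p.K) (SU N) (FluctV N), (∀ i, i ≤ k → ω i = ω' i) →
          (θ.zhAt p s).quad j (s.init.Λ (j + 1)) ω = (θ.zhAt p s).quad j (s.init.Λ (j + 1)) ω') →
        -- measurability of the residual serving `s′`
        (∀ j (Y : Set (Site (F.P p.K) 0)), Measurable ((θ.zhAt p s).ζ0 j Y)) →
        (∀ j (Λ' : Set (Site (F.P p.K) 0)), Measurable ((θ.zhAt p s).quad j Λ')) →
        -- per old branch: A-fibre domination (K0b)
        (∀ S ∈ admSOfRecord F θ.ν θ.τ9.M (gOfRecord₁₃ F N θ.toStage13Params p) p.K k s.init, ∀ j : ℕ,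
          ∃ ŵ : (↥(Set.toFinite (B10Eq42TorusConstraint.bondsIn j ((s.init.Λ (j + 1))ᶜ ∩ s.init.Ω (j + 1)))).toFinset → FluctV N) → ℝ≥0∞, Measurable ŵ ∧
            (∫⁻ a, ŵ a ∂(Measure.pi fun _ : ↥(Set.toFinite (B10Eq42TorusConstraint.bondsIn j ((s.init.Λ (j + 1))ᶜ ∩ s.init.Ω (j + 1)))).toFinset => (volume : Measure (FluctV N)))) ≠ ⊤ ∧
            ∀ ω, ENNReal.ofReal ((WtOfRecord₁₃H F N θ p s).w j (s.init.Λ (j + 1)) ((s.init.Λ (j + 1))ᶜ ∩ s.init.Ω (j + 1)) (S (j + 1)) ω) ≤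
              ŵ (fun b : ↥(Set.toFinite (B10Eq42TorusConstraint.bondsIn j ((s.init.Λ (j + 1))ᶜ ∩ s.init.Ω (j + 1)))).toFinset => (ω j).2 b)) →
        (slotsTOfRecord F N θ.ν θ.τ9 (EOfRecord₁₃ F N θ.toStage13Params) (wOfRecord₉ F N θ.toStage9Params) θ.ppSel p
            (gOfRecord₁₃ F N θ.toStage13Params p) (k + 1) s = 0 ∨
          ∀ᵐ V' ∂fieldMeasure (F.P p.K) (k + 1) (SU N),
            chiSeqOfRecord F N θ.ν θ.τ9.M (gOfRecord₁₃ F N θ.toStage13Params p) p.K (k + 1) s V' ≠ 0 →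
              slotsTOfRecord F N θ.ν θ.τ9 (EOfRecord₁₃ F N θ.toStage13Params) (wOfRecord₉ F N θ.toStage9Params) θ.ppSel p
                  (gOfRecord₁₃ F N θ.toStage13Params p) (k + 1) s V' =
                sect2Slot F N (FluctV N) p.K (settingOfRecord₁₃ F N θ.toStage13Params p) (θ.rzAt p s) (WtOfRecord₁₃H F N θ p s) s
                  (t s.init) (Ek s.init) (UbgOfRecord₁₃CoP F N θ.toStage13Params p (k + 1) s) V') :=
  exists_local_witness_clause_succ_of_hasSect2FormAtZS_of_borelB_of_bgReadCharged θ p h hU hθ hpos hk hM hw cR Γr hreg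
    (bgProvisoΛ_charged_of_sep_of_junctionCharged θ p hM₁ hle cR Γr hbg hJ) t₀ E₀ hform₀ hBt

end JunctionCharged

/-! ## §2  The two faces with the junction's top half discharged (p596158 layer), keyed on the bg FACT, cover from `L·M₂ ∣ M` + `M = L^a` — no run guard at all -/

section Solvable

variable (θ : Stage13HParams F N) (p : B12.RunParams)

/-- **★★ THE SLaw-KEYED NO-EXPANSION 𝐓-STEP FACE WITH THE JUNCTION's TOP HALF DISCHARGED, KEYED ON THE bg FACT, AT `M = L^a` — NO RUN GUARD AT ALL**: dag-n11-d's
`exists_local_witness_clause_succ_of_sLaw₁₃CoPH_of_sep_of_solvable` (p596158∕`…ChargedSepJunctionOfSolvable`) with `(Provisos₁₃SepCoPH.bg, PartCompat₁₃)` ↦ `hbg` (the P11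
row's CONTENT at `(p, k)`) and the cube-cover binder `hcov` DISCHARGED by dag-n11-w4's `cover_row_of_nesting_of_powM` (p618164 §4: `L·M₂ ∣ M` and `M = L^a` alone — at a
compatible level the grids nest, at a one-block level the region is `∅` or the torus).  Remaining rows exactly: core provisos, `ZhUnity`, admissibility, `s2.Pos`, `0 < M₁ ≤ M`,
`k < K`, `1 ≤ M`, the window at `k`, `hbg`, 12a″'s `RegOn`, `1 ≤ k ≤ m + K`, `2 ≤ cR`, the five numeric rows at `k`, K0's per-cube [15]-solvability on the χ-support, the
(7)-data clause, `L·M₂ ∣ M`, `M = L^a`, `SLaw₁₃CoPH θ p k`.  Conclusion VERBATIM.  (dag-n11-w4 g4: «below the floor what stays guarded is not geometry but K0's row `bg`» —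
here in kernel form: the guard is GONE from the face, its former content is the displayed `hbg`.) [cite: Balaban1988Convergent, Theorem p.245, Thm 1 p.262, (2.1) p.254, (2.5) p.255, (2.10) p.256, (2.16)–(2.17) p.257, p.267, (2.28) p.259, (3.24)–(3.25) p.270; Balaban1985Variational, Thm 1 (7)–(8) pp.278–279; Balaban1985Averaging, Prop. 2 p.26] -/
theorem exists_local_witness_clause_succ_of_sLaw₁₃CoPH_of_sep_of_solvable_of_bgFact_of_powM (h : θ.Provisos₁₃CoPH F N) (hU : θ.ZhUnity F N) (hθ : θ.Admissible F N)
    (hpos : θ.s2.Pos) (hM₁ : 0 < θ.ν.M₁) (hle : θ.ν.M₁ ≤ θ.τ9.M) {k : ℕ} (hk : k < p.K) (hM : 1 ≤ θ.τ9.M)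
    (hw : Step.InInterval θ.γ k (gOfRecord₁₃ F N θ.toStage13Params p))
    (hbg : BgProvisoΛ F N p.K (settingOfRecord₁₃ F N θ.toStage13Params p) (θ.Rz p.K) θ.τ9.M k (suppOfRecord₁₃SepCoP F N θ.toStage13Params p k)
      (UbgOfRecord₁₃CoP F N θ.toStage13Params p k))
    (hreg : ∀ s₀ : SeqOfRecord F θ.ν θ.τ9.M (gOfRecord₁₃ F N θ.toStage13Params p) p.K k,
      (θ.zhAt p s₀).RegOn F N (FluctV N) θ.ν θ.s2.cR p (gOfRecord₁₃ F N θ.toStage13Params p) (readSelOfSeq F p (suppDomOfRecord F θ.ν p.K s₀.Ω) s₀.Ω))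
    (hk1 : 1 ≤ k) (hkK : k ≤ (F.P p.K).m + (F.P p.K).K) (hcR : 2 ≤ θ.s2.cR)
    (hdiv : (F.P p.K).L * θ.ν.M₂ ∣ θ.τ9.M) {a : ℕ} (hMa : θ.τ9.M = F.L ^ a)
    (h3 : 3 * side (F.P p.K).L θ.ν.M₁ k ≤ cubeSide (F.P p.K).L θ.ν.M₂ (RkOfRecord (F.P p.K).L θ.ν.r (gOfRecord₁₃ F N θ.toStage13Params p k)) k)
    (hR : (F.P p.K).L ^ k + (((F.P p.K).d + 4) * (F.P p.K).L + 2) * (∑ l ∈ Finset.range k, (F.P p.K).L ^ l) + 2 ≤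
      cubeSide (F.P p.K).L θ.ν.M₂ (RkOfRecord (F.P p.K).L θ.ν.r (gOfRecord₁₃ F N θ.toStage13Params p k)) k)
    (hε : 0 < epsOfRecord θ.ν (gOfRecord₁₃ F N θ.toStage13Params p) k)
    (hε3 : (143 * (((((F.P p.K).d + 4 : ℕ) : ℝ)) ^ 2 / 4) ^ 2) * epsOfRecord θ.ν (gOfRecord₁₃ F N θ.toStage13Params p) k ≤ 1 / 3)
    (hε2 : 2 * epsOfRecord θ.ν (gOfRecord₁₃ F N θ.toStage13Params p) k ≤ 2 * ExpMeanLog.deltaSU (Fin N) / ((((F.P p.K).d + 4) * (F.P p.K).L : ℕ) : ℝ) ^ 2)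
    (hsolv : ∀ s₀ : SeqOfRecord F θ.ν θ.τ9.M (gOfRecord₁₃ F N θ.toStage13Params p) p.K k,
      slotsOfRecord F N θ.ν θ.τ9 (EOfRecord₁₃ F N θ.toStage13Params) (wOfRecord₉ F N θ.toStage9Params) θ.ppSel p
        (gOfRecord₁₃ F N θ.toStage13Params p) k s₀ ≠ 0 → Sect2.SeqSeparated θ.ν.M₁ s₀ → ∀ Wc : MSField (F.P p.K) (SU N),
      chiSeqOfRecord F N θ.ν θ.τ9.M (gOfRecord₁₃ F N θ.toStage13Params p) p.K k s₀ (Wc k) ≠ 0 →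
      ∀ a ∈ cubesIn (fun a : ↥(cubeIndices (F.P p.K) (cubeSide (F.P p.K).L θ.ν.M₂ (RkOfRecord (F.P p.K).L θ.ν.r (gOfRecord₁₃ F N θ.toStage13Params p k)) k)) =>
          cubeEnl (F.P p.K) (cubeSide (F.P p.K).L θ.ν.M₂ (RkOfRecord (F.P p.K).L θ.ν.r (gOfRecord₁₃ F N θ.toStage13Params p k)) k) a 0) (s₀.Ω k),
        ∃ U₀, IsMinimizer (avOfRecord F N p.K) {U | PlaqSmall (θ.ν.εreg * (F.P p.K).eta k ^ 2) U}
          (Bj θ.ν.M₁ (cubeEnl (F.P p.K) (cubeSide (F.P p.K).L θ.ν.M₂ (RkOfRecord (F.P p.K).L θ.ν.r (gOfRecord₁₃ F N θ.toStage13Params p k)) k) a 4) k)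
          (avgFamily (avOfRecord F N p.K) (qsstarGIter0 k (Wc k))) U₀)
    (h7 : ∀ s₀ : SeqOfRecord F θ.ν θ.τ9.M (gOfRecord₁₃ F N θ.toStage13Params p) p.K k,
      slotsOfRecord F N θ.ν θ.τ9 (EOfRecord₁₃ F N θ.toStage13Params) (wOfRecord₉ F N θ.toStage9Params) θ.ppSel p
        (gOfRecord₁₃ F N θ.toStage13Params p) k s₀ ≠ 0 → Sect2.SeqSeparated θ.ν.M₁ s₀ → ∀ Wc : MSField (F.P p.K) (SU N),
      chiSeqOfRecord F N θ.ν θ.τ9.M (gOfRecord₁₃ F N θ.toStage13Params p) p.K k s₀ (Wc k) ≠ 0 →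
      (∀ j, j < k → PlaqSmallOn (plaqsOf (pts j (readSelOfSeq F p (suppDomOfRecord F θ.ν p.K s₀.Ω) s₀.Ω j (s₀.Ω (j + 1))ᶜ)))
        (θ.s2.cR * epsOfRecord θ.ν (gOfRecord₁₃ F N θ.toStage13Params p) j) (Wc j)) →
      ∀ m, m + 1 ≤ k → PlaqSmallOn (Sect2.printedPlaqs s₀.Ω k (m + 1)) (θ.s2.cR * epsOfRecord θ.ν (gOfRecord₁₃ F N θ.toStage13Params p) (m + 1))
        (Sect2.mixedField (avOfRecord F N p.K) (genSet s₀.Ω k (m + 1)) (Wc (m + 1)) (Wc m)))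
    (hS : SLaw₁₃CoPH F N θ p k) :
    ∃ (t : SeqOfRecord F θ.ν θ.τ9.M (gOfRecord₁₃ F N θ.toStage13Params p) p.K k → Sect2.TermValues (F.P p.K) (MatA N) (FluctV N) θ.τ9.M)
      (Ek : SeqOfRecord F θ.ν θ.τ9.M (gOfRecord₁₃ F N θ.toStage13Params p) p.K k → ℝ),
      HasSect2FormAtZS F N (FluctV N) p.K (settingOfRecord₁₃ F N θ.toStage13Params p) k (θ.rzAt p) (WtOfRecord₁₃H F N θ p)
          (UbgOfRecord₁₃CoP F N θ.toStage13Params p k)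
          (fun s₀ t₀ => Sect2.LawsRT (sect2TowerOfRecord F N (FluctV N) p.K (settingOfRecord₁₃ F N θ.toStage13Params p) (θ.rzAt p s₀) s₀ t₀)
            (settingOfRecord₁₃ F N θ.toStage13Params p).lf k)
          (slotsOfRecord F N θ.ν θ.τ9 (EOfRecord₁₃ F N θ.toStage13Params) (wOfRecord₉ F N θ.toStage9Params) θ.ppSel p
            (gOfRecord₁₃ F N θ.toStage13Params p) k) t Ek ∧
      (∀ s₀, IsFluctLocal k (t s₀)) ∧
      ∀ (s : SeqOfRecord F θ.ν θ.τ9.M (gOfRecord₁₃ F N θ.toStage13Params p) p.K (k + 1)), s.Ω (k + 1) = ∅ →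
        -- (P) prefix agreement below `k`
        (∀ j, j < k → (θ.zhAt p s).ζ0 j = (θ.zhAt p s.init).ζ0 j ∧ (θ.zhAt p s).quad j = (θ.zhAt p s.init).quad j) →
        -- (V) the generation-`k` pin with the old front factor
        (∀ (V' : GaugeField (F.P p.K) (k + 1) (SU N)) (U₀ : GaugeField (F.P p.K) k (SU N)),
          (θ.zhAt p s).ζ0 k Set.univ (pairCfgAt (V := FluctV N) k V' U₀) =
            chiSeqOfRecord F N θ.ν θ.τ9.M (gOfRecord₁₃ F N θ.toStage13Params p) p.K k s.init U₀ *
              wOfRecord₉ F N θ.toStage9Params p (gOfRecord₁₃ F N θ.toStage13Params p) k s U₀ ((avOfRecord F N p.K k).avg U₀)) →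
        -- `quad_k(∅) = 0` on the two-scale configurations
        (∀ (V' : GaugeField (F.P p.K) (k + 1) (SU N)) (U₀ : GaugeField (F.P p.K) k (SU N)), (θ.zhAt p s).quad k ∅ (pairCfgAt (V := FluctV N) k V' U₀) = 0) →
        -- `k`-locality of `quad_j(Λ_{j+1})`, `j < k`
        (∀ j, j < k → ∀ ω ω' : MultiCfg (F.P p.K) (SU N) (FluctV N), (∀ i, i ≤ k → ω i = ω' i) →
          (θ.zhAt p s).quad j (s.init.Λ (j + 1)) ω = (θ.zhAt p s).quad j (s.init.Λ (j + 1)) ω') →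
        -- measurability of the residual serving `s′`
        (∀ j (Y : Set (Site (F.P p.K) 0)), Measurable ((θ.zhAt p s).ζ0 j Y)) →
        (∀ j (Λ' : Set (Site (F.P p.K) 0)), Measurable ((θ.zhAt p s).quad j Λ')) →
        -- per old branch: A-fibre domination (K0b)
        (∀ S ∈ admSOfRecord F θ.ν θ.τ9.M (gOfRecord₁₃ F N θ.toStage13Params p) p.K k s.init, ∀ j : ℕ,
          ∃ ŵ : (↥(Set.toFinite (B10Eq42TorusConstraint.bondsIn j ((s.init.Λ (j + 1))ᶜ ∩ s.init.Ω (j + 1)))).toFinset → FluctV N) → ℝ≥0∞, Measurable ŵ ∧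
            (∫⁻ a, ŵ a ∂(Measure.pi fun _ : ↥(Set.toFinite (B10Eq42TorusConstraint.bondsIn j ((s.init.Λ (j + 1))ᶜ ∩ s.init.Ω (j + 1)))).toFinset => (volume : Measure (FluctV N)))) ≠ ⊤ ∧
            ∀ ω, ENNReal.ofReal ((WtOfRecord₁₃H F N θ p s).w j (s.init.Λ (j + 1)) ((s.init.Λ (j + 1))ᶜ ∩ s.init.Ω (j + 1)) (S (j + 1)) ω) ≤
              ŵ (fun b : ↥(Set.toFinite (B10Eq42TorusConstraint.bondsIn j ((s.init.Λ (j + 1))ᶜ ∩ s.init.Ω (j + 1)))).toFinset => (ω j).2 b)) →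
        -- def-T: the 𝐁-terms of the witness at the parent history, READ AT THE EMBEDDED BACKGROUND, are JOINTLY measurable in `(U, A)` (LOCATED residue)
        (∀ (S' : ℕ → Set (Site (F.P p.K) 0)) (j : ℕ) (X : (Sect2.domSys (F.P p.K) θ.τ9.M j).Dom),
          Measurable (fun q : GaugeField (F.P p.K) 0 (SU N) × MSFluct (F.P p.K) (FluctV N) =>
            ((t s.init).B j X (Sect2.ofBackgroundC (settingOfRecord₁₃ F N θ.toStage13Params p).ι q.1) (S', q.2)).re)) →
        (slotsTOfRecord F N θ.ν θ.τ9 (EOfRecord₁₃ F N θ.toStage13Params) (wOfRecord₉ F N θ.toStage9Params) θ.ppSel p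
            (gOfRecord₁₃ F N θ.toStage13Params p) (k + 1) s = 0 ∨
          ∀ᵐ V' ∂fieldMeasure (F.P p.K) (k + 1) (SU N),
            chiSeqOfRecord F N θ.ν θ.τ9.M (gOfRecord₁₃ F N θ.toStage13Params p) p.K (k + 1) s V' ≠ 0 →
              slotsTOfRecord F N θ.ν θ.τ9 (EOfRecord₁₃ F N θ.toStage13Params) (wOfRecord₉ F N θ.toStage9Params) θ.ppSel p
                  (gOfRecord₁₃ F N θ.toStage13Params p) (k + 1) s V' =
                sect2Slot F N (FluctV N) p.K (settingOfRecord₁₃ F N θ.toStage13Params p) (θ.rzAt p s) (WtOfRecord₁₃H F N θ p s) s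
                  (t s.init) (Ek s.init) (UbgOfRecord₁₃CoP F N θ.toStage13Params p (k + 1) s) V') :=
  exists_local_witness_clause_succ_of_sLaw₁₃CoPH_of_sep_of_junctionCharged_of_bgFact θ p h hU hθ hpos hM₁ hle hk hM hw hbg θ.s2.cR
    (fun s₀ => readSelOfSeq F p (suppDomOfRecord F θ.ν p.K s₀.Ω) s₀.Ω) hreg
    (sepJunctionCharged_of_solvable θ p hk1 hkK hcR hM₁ h3 hR hε hε3 hε2 hsolv
      (fun s₀ => cover_row_of_nesting_of_powM θ p hdiv hMa (k := k) k hk1 le_rfl s₀) h7) hS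

/-- **★★ THE WITNESS-FIRST NO-EXPANSION 𝐓-STEP FACE WITH THE JUNCTION's TOP HALF DISCHARGED, KEYED ON THE bg FACT, AT `M = L^a` — NO RUN GUARD AT ALL**: dag-n11-d's
`exists_local_witness_clause_succ_of_hasSect2FormAtZS_of_borelB_of_sep_of_solvable` with `(Provisos₁₃SepCoPH.bg, PartCompat₁₃)` ↦ `hbg` and `hcov` discharged by
`cover_row_of_nesting_of_powM`; conclusion VERBATIM (no row on the witness beyond `hBt`). [cite: Balaban1988Convergent, Theorem p.245, Thm 1 p.262, (2.1) p.254, (2.5) p.255, (2.10) p.256, (2.16)–(2.17) p.257, p.267, (2.28) p.259, (3.24)–(3.25) p.270; Balaban1985Variational, Thm 1 (7)–(8) pp.278–279; Balaban1985Averaging, Prop. 2 p.26] -/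
theorem exists_local_witness_clause_succ_of_hasSect2FormAtZS_of_borelB_of_sep_of_solvable_of_bgFact_of_powM (h : θ.Provisos₁₃CoPH F N) (hU : θ.ZhUnity F N)
    (hθ : θ.Admissible F N) (hpos : θ.s2.Pos) (hM₁ : 0 < θ.ν.M₁) (hle : θ.ν.M₁ ≤ θ.τ9.M) {k : ℕ} (hk : k < p.K) (hM : 1 ≤ θ.τ9.M)
    (hw : Step.InInterval θ.γ k (gOfRecord₁₃ F N θ.toStage13Params p))
    (hbg : BgProvisoΛ F N p.K (settingOfRecord₁₃ F N θ.toStage13Params p) (θ.Rz p.K) θ.τ9.M k (suppOfRecord₁₃SepCoP F N θ.toStage13Params p k)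
      (UbgOfRecord₁₃CoP F N θ.toStage13Params p k))
    (hreg : ∀ s₀ : SeqOfRecord F θ.ν θ.τ9.M (gOfRecord₁₃ F N θ.toStage13Params p) p.K k,
      (θ.zhAt p s₀).RegOn F N (FluctV N) θ.ν θ.s2.cR p (gOfRecord₁₃ F N θ.toStage13Params p) (readSelOfSeq F p (suppDomOfRecord F θ.ν p.K s₀.Ω) s₀.Ω))
    (hk1 : 1 ≤ k) (hkK : k ≤ (F.P p.K).m + (F.P p.K).K) (hcR : 2 ≤ θ.s2.cR)
    (hdiv : (F.P p.K).L * θ.ν.M₂ ∣ θ.τ9.M) {a : ℕ} (hMa : θ.τ9.M = F.L ^ a)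
    (h3 : 3 * side (F.P p.K).L θ.ν.M₁ k ≤ cubeSide (F.P p.K).L θ.ν.M₂ (RkOfRecord (F.P p.K).L θ.ν.r (gOfRecord₁₃ F N θ.toStage13Params p k)) k)
    (hR : (F.P p.K).L ^ k + (((F.P p.K).d + 4) * (F.P p.K).L + 2) * (∑ l ∈ Finset.range k, (F.P p.K).L ^ l) + 2 ≤
      cubeSide (F.P p.K).L θ.ν.M₂ (RkOfRecord (F.P p.K).L θ.ν.r (gOfRecord₁₃ F N θ.toStage13Params p k)) k)
    (hε : 0 < epsOfRecord θ.ν (gOfRecord₁₃ F N θ.toStage13Params p) k)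
    (hε3 : (143 * (((((F.P p.K).d + 4 : ℕ) : ℝ)) ^ 2 / 4) ^ 2) * epsOfRecord θ.ν (gOfRecord₁₃ F N θ.toStage13Params p) k ≤ 1 / 3)
    (hε2 : 2 * epsOfRecord θ.ν (gOfRecord₁₃ F N θ.toStage13Params p) k ≤ 2 * ExpMeanLog.deltaSU (Fin N) / ((((F.P p.K).d + 4) * (F.P p.K).L : ℕ) : ℝ) ^ 2)
    (hsolv : ∀ s₀ : SeqOfRecord F θ.ν θ.τ9.M (gOfRecord₁₃ F N θ.toStage13Params p) p.K k,
      slotsOfRecord F N θ.ν θ.τ9 (EOfRecord₁₃ F N θ.toStage13Params) (wOfRecord₉ F N θ.toStage9Params) θ.ppSel p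
        (gOfRecord₁₃ F N θ.toStage13Params p) k s₀ ≠ 0 → Sect2.SeqSeparated θ.ν.M₁ s₀ → ∀ Wc : MSField (F.P p.K) (SU N),
      chiSeqOfRecord F N θ.ν θ.τ9.M (gOfRecord₁₃ F N θ.toStage13Params p) p.K k s₀ (Wc k) ≠ 0 →
      ∀ a ∈ cubesIn (fun a : ↥(cubeIndices (F.P p.K) (cubeSide (F.P p.K).L θ.ν.M₂ (RkOfRecord (F.P p.K).L θ.ν.r (gOfRecord₁₃ F N θ.toStage13Params p k)) k)) =>
          cubeEnl (F.P p.K) (cubeSide (F.P p.K).L θ.ν.M₂ (RkOfRecord (F.P p.K).L θ.ν.r (gOfRecord₁₃ F N θ.toStage13Params p k)) k) a 0) (s₀.Ω k),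
        ∃ U₀, IsMinimizer (avOfRecord F N p.K) {U | PlaqSmall (θ.ν.εreg * (F.P p.K).eta k ^ 2) U}
          (Bj θ.ν.M₁ (cubeEnl (F.P p.K) (cubeSide (F.P p.K).L θ.ν.M₂ (RkOfRecord (F.P p.K).L θ.ν.r (gOfRecord₁₃ F N θ.toStage13Params p k)) k) a 4) k)
          (avgFamily (avOfRecord F N p.K) (qsstarGIter0 k (Wc k))) U₀)
    (h7 : ∀ s₀ : SeqOfRecord F θ.ν θ.τ9.M (gOfRecord₁₃ F N θ.toStage13Params p) p.K k,
      slotsOfRecord F N θ.ν θ.τ9 (EOfRecord₁₃ F N θ.toStage13Params) (wOfRecord₉ F N θ.toStage9Params) θ.ppSel p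
        (gOfRecord₁₃ F N θ.toStage13Params p) k s₀ ≠ 0 → Sect2.SeqSeparated θ.ν.M₁ s₀ → ∀ Wc : MSField (F.P p.K) (SU N),
      chiSeqOfRecord F N θ.ν θ.τ9.M (gOfRecord₁₃ F N θ.toStage13Params p) p.K k s₀ (Wc k) ≠ 0 →
      (∀ j, j < k → PlaqSmallOn (plaqsOf (pts j (readSelOfSeq F p (suppDomOfRecord F θ.ν p.K s₀.Ω) s₀.Ω j (s₀.Ω (j + 1))ᶜ)))
        (θ.s2.cR * epsOfRecord θ.ν (gOfRecord₁₃ F N θ.toStage13Params p) j) (Wc j)) →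
      ∀ m, m + 1 ≤ k → PlaqSmallOn (Sect2.printedPlaqs s₀.Ω k (m + 1)) (θ.s2.cR * epsOfRecord θ.ν (gOfRecord₁₃ F N θ.toStage13Params p) (m + 1))
        (Sect2.mixedField (avOfRecord F N p.K) (genSet s₀.Ω k (m + 1)) (Wc (m + 1)) (Wc m)))
    (t₀ : SeqOfRecord F θ.ν θ.τ9.M (gOfRecord₁₃ F N θ.toStage13Params p) p.K k → Sect2.TermValues (F.P p.K) (MatA N) (FluctV N) θ.τ9.M)
    (E₀ : SeqOfRecord F θ.ν θ.τ9.M (gOfRecord₁₃ F N θ.toStage13Params p) p.K k → ℝ)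
    (hform₀ : HasSect2FormAtZS F N (FluctV N) p.K (settingOfRecord₁₃ F N θ.toStage13Params p) k (θ.rzAt p) (WtOfRecord₁₃H F N θ p)
      (UbgOfRecord₁₃CoP F N θ.toStage13Params p k)
      (fun s₀ t' => Sect2.LawsRT (sect2TowerOfRecord F N (FluctV N) p.K (settingOfRecord₁₃ F N θ.toStage13Params p) (θ.rzAt p s₀) s₀ t')
        (settingOfRecord₁₃ F N θ.toStage13Params p).lf k)
      (slotsOfRecord F N θ.ν θ.τ9 (EOfRecord₁₃ F N θ.toStage13Params) (wOfRecord₉ F N θ.toStage9Params) θ.ppSel p (gOfRecord₁₃ F N θ.toStage13Params p) k) t₀ E₀)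
    (hBt : ∀ s₀ (S' : ℕ → Set (Site (F.P p.K) 0)) (j : ℕ) (X : (Sect2.domSys (F.P p.K) θ.τ9.M j).Dom),
      Measurable (fun q : GaugeField (F.P p.K) 0 (SU N) × MSFluct (F.P p.K) (FluctV N) =>
        (t₀ s₀).B j X (Sect2.ofBackgroundC (settingOfRecord₁₃ F N θ.toStage13Params p).ι q.1) (S', q.2))) :
    ∃ (t : SeqOfRecord F θ.ν θ.τ9.M (gOfRecord₁₃ F N θ.toStage13Params p) p.K k → Sect2.TermValues (F.P p.K) (MatA N) (FluctV N) θ.τ9.M)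
      (Ek : SeqOfRecord F θ.ν θ.τ9.M (gOfRecord₁₃ F N θ.toStage13Params p) p.K k → ℝ),
      HasSect2FormAtZS F N (FluctV N) p.K (settingOfRecord₁₃ F N θ.toStage13Params p) k (θ.rzAt p) (WtOfRecord₁₃H F N θ p)
          (UbgOfRecord₁₃CoP F N θ.toStage13Params p k)
          (fun s₀ t₀ => Sect2.LawsRT (sect2TowerOfRecord F N (FluctV N) p.K (settingOfRecord₁₃ F N θ.toStage13Params p) (θ.rzAt p s₀) s₀ t₀)
            (settingOfRecord₁₃ F N θ.toStage13Params p).lf k)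
          (slotsOfRecord F N θ.ν θ.τ9 (EOfRecord₁₃ F N θ.toStage13Params) (wOfRecord₉ F N θ.toStage9Params) θ.ppSel p
            (gOfRecord₁₃ F N θ.toStage13Params p) k) t Ek ∧
      (∀ s₀, IsFluctLocal k (t s₀)) ∧
      ∀ (s : SeqOfRecord F θ.ν θ.τ9.M (gOfRecord₁₃ F N θ.toStage13Params p) p.K (k + 1)), s.Ω (k + 1) = ∅ →
        -- (P) prefix agreement below `k`
        (∀ j, j < k → (θ.zhAt p s).ζ0 j = (θ.zhAt p s.init).ζ0 j ∧ (θ.zhAt p s).quad j = (θ.zhAt p s.init).quad j) →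
        -- (V) the generation-`k` pin with the old front factor
        (∀ (V' : GaugeField (F.P p.K) (k + 1) (SU N)) (U₀ : GaugeField (F.P p.K) k (SU N)),
          (θ.zhAt p s).ζ0 k Set.univ (pairCfgAt (V := FluctV N) k V' U₀) =
            chiSeqOfRecord F N θ.ν θ.τ9.M (gOfRecord₁₃ F N θ.toStage13Params p) p.K k s.init U₀ *
              wOfRecord₉ F N θ.toStage9Params p (gOfRecord₁₃ F N θ.toStage13Params p) k s U₀ ((avOfRecord F N p.K k).avg U₀)) →
        -- `quad_k(∅) = 0` on the two-scale configurations
        (∀ (V' : GaugeField (F.P p.K) (k + 1) (SU N)) (U₀ : GaugeField (F.P p.K) k (SU N)), (θ.zhAt p s).quad k ∅ (pairCfgAt (V := FluctV N) k V' U₀) = 0) →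
        -- `k`-locality of `quad_j(Λ_{j+1})`, `j < k`
        (∀ j, j < k → ∀ ω ω' : MultiCfg (F.P p.K) (SU N) (FluctV N), (∀ i, i ≤ k → ω i = ω' i) →
          (θ.zhAt p s).quad j (s.init.Λ (j + 1)) ω = (θ.zhAt p s).quad j (s.init.Λ (j + 1)) ω') →
        -- measurability of the residual serving `s′`
        (∀ j (Y : Set (Site (F.P p.K) 0)), Measurable ((θ.zhAt p s).ζ0 j Y)) →
        (∀ j (Λ' : Set (Site (F.P p.K) 0)), Measurable ((θ.zhAt p s).quad j Λ')) →
        -- per old branch: A-fibre domination (K0b)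
        (∀ S ∈ admSOfRecord F θ.ν θ.τ9.M (gOfRecord₁₃ F N θ.toStage13Params p) p.K k s.init, ∀ j : ℕ,
          ∃ ŵ : (↥(Set.toFinite (B10Eq42TorusConstraint.bondsIn j ((s.init.Λ (j + 1))ᶜ ∩ s.init.Ω (j + 1)))).toFinset → FluctV N) → ℝ≥0∞, Measurable ŵ ∧
            (∫⁻ a, ŵ a ∂(Measure.pi fun _ : ↥(Set.toFinite (B10Eq42TorusConstraint.bondsIn j ((s.init.Λ (j + 1))ᶜ ∩ s.init.Ω (j + 1)))).toFinset => (volume : Measure (FluctV N)))) ≠ ⊤ ∧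
            ∀ ω, ENNReal.ofReal ((WtOfRecord₁₃H F N θ p s).w j (s.init.Λ (j + 1)) ((s.init.Λ (j + 1))ᶜ ∩ s.init.Ω (j + 1)) (S (j + 1)) ω) ≤
              ŵ (fun b : ↥(Set.toFinite (B10Eq42TorusConstraint.bondsIn j ((s.init.Λ (j + 1))ᶜ ∩ s.init.Ω (j + 1)))).toFinset => (ω j).2 b)) →
        (slotsTOfRecord F N θ.ν θ.τ9 (EOfRecord₁₃ F N θ.toStage13Params) (wOfRecord₉ F N θ.toStage9Params) θ.ppSel p
            (gOfRecord₁₃ F N θ.toStage13Params p) (k + 1) s = 0 ∨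
          ∀ᵐ V' ∂fieldMeasure (F.P p.K) (k + 1) (SU N),
            chiSeqOfRecord F N θ.ν θ.τ9.M (gOfRecord₁₃ F N θ.toStage13Params p) p.K (k + 1) s V' ≠ 0 →
              slotsTOfRecord F N θ.ν θ.τ9 (EOfRecord₁₃ F N θ.toStage13Params) (wOfRecord₉ F N θ.toStage9Params) θ.ppSel p
                  (gOfRecord₁₃ F N θ.toStage13Params p) (k + 1) s V' =
                sect2Slot F N (FluctV N) p.K (settingOfRecord₁₃ F N θ.toStage13Params p) (θ.rzAt p s) (WtOfRecord₁₃H F N θ p s) s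
                  (t s.init) (Ek s.init) (UbgOfRecord₁₃CoP F N θ.toStage13Params p (k + 1) s) V') :=
  exists_local_witness_clause_succ_of_hasSect2FormAtZS_of_borelB_of_sep_of_junctionCharged_of_bgFact θ p h hU hθ hpos hM₁ hle hk hM hw hbg θ.s2.cR
    (fun s₀ => readSelOfSeq F p (suppDomOfRecord F θ.ν p.K s₀.Ω) s₀.Ω) hreg
    (sepJunctionCharged_of_solvable θ p hk1 hkK hcR hM₁ h3 hR hε hε3 hε2 hsolv
      (fun s₀ => cover_row_of_nesting_of_powM θ p hdiv hMa (k := k) k hk1 le_rfl s₀) h7) t₀ E₀ hform₀ hBt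

end Solvable

end Summit.QuantumFields.YangMills.Theorems.BalabanUVNodesN11ChargedSepFacesOfBgFact

end
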